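import Summits.KontsevichZagierPeriods.Zeta5Search.LaiSweepShard

/-!
# `κ₃` sweep certificate — shard file 012 of 127 (shards 84–90 of 889)

HONEST FRAMING. Systematic search; no irrationality claim unless certified. This file only checks,
by `decide +kernel`, shards 84–90 of the order-cell sweep of the `κ₃` point `(74, 2180, 444; δ74)`
(engine `LaiSweepEngine`, soundness `LaiSweepJump/Free/Eval/Shard/Kappa3`; a shard is `⟨regime, n,
p, q, p', q', Lo, Up⟩`: `n` cells from `p/q` to `p'/q'` with integer rate sums in `[Lo, Up]`, `K =
128`, `D = 2^40`). It draws NO conclusion: only the capstone `LaiKappa3SweepCert`, which needs all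
127 shard files, does. Kernel cost of this file ≈ 560 cells × 0.3 s.
-/

namespace Summit.KontsevichZagierPeriods.Zeta5Search.Sweep

set_option maxHeartbeats 100000000 in
/-- Shard 84: 80 cells of regime A from `29/1299` to `51/2260`.
[cite: Lai2024BallRivoal, §4 Lemma 4.3] -/
theorem shard084 :
    Shard.check 128 (2^40)
      ⟨false, 80, 29, 1299, 51, 2260, 64954503202014, 64980563278066⟩ = true := by
  decide +kernel

set_option maxHeartbeats 100000000 in
/-- Shard 85: 80 cells of regime A from `51/2260` to `8/351`.
[cite: Lai2024BallRivoal, §4 Lemma 4.3] -/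
theorem shard085 :
    Shard.check 128 (2^40)
      ⟨false, 80, 51, 2260, 8, 351, 58906829355892, 58933153399349⟩ = true := by
  decide +kernel

set_option maxHeartbeats 100000000 in
/-- Shard 86: 80 cells of regime A from `8/351` to `29/1260`.
[cite: Lai2024BallRivoal, §4 Lemma 4.3] -/
theorem shard086 :
    Shard.check 128 (2^40)
      ⟨false, 80, 8, 351, 29, 1260, 57526494592351, 57549536247904⟩ = true := by
  decide +kernel

set_option maxHeartbeats 100000000 in
/-- Shard 87: 80 cells of regime A from `29/1260` to `53/2278`.
[cite: Lai2024BallRivoal, §4 Lemma 4.3] -/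
theorem shard087 :
    Shard.check 128 (2^40)
      ⟨false, 80, 29, 1260, 53, 2278, 68025823905387, 68054797734874⟩ = true := by
  decide +kernel

set_option maxHeartbeats 100000000 in
/-- Shard 88: 80 cells of regime A from `53/2278` to `61/2598`.
[cite: Lai2024BallRivoal, §4 Lemma 4.3] -/
theorem shard088 :
    Shard.check 128 (2^40)
      ⟨false, 80, 53, 2278, 61, 2598, 58894363576466, 58917398590357⟩ = true := by
  decide +kernel

set_option maxHeartbeats 100000000 in
/-- Shard 89: 80 cells of regime A from `61/2598` to `7/295`.
[cite: Lai2024BallRivoal, §4 Lemma 4.3] -/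
theorem shard089 :
    Shard.check 128 (2^40)
      ⟨false, 80, 61, 2598, 7, 295, 67512310906061, 67542367192627⟩ = true := by
  decide +kernel

set_option maxHeartbeats 100000000 in
/-- Shard 90: 80 cells of regime A from `7/295` to `10/417`.
[cite: Lai2024BallRivoal, §4 Lemma 4.3] -/
theorem shard090 :
    Shard.check 128 (2^40)
      ⟨false, 80, 7, 295, 10, 417, 66605182004607, 66638673280004⟩ = true := by
  decide +kernel

/-- The checked shards of this file, in order. [folklore] -/
def shards012 : List (CheckedShard 128 (2^40)) :=
  [⟨_, shard084⟩, ⟨_, shard085⟩, ⟨_, shard086⟩, ⟨_, shard087⟩, ⟨_, shard088⟩,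
    ⟨_, shard089⟩, ⟨_, shard090⟩]

end Summit.KontsevichZagierPeriods.Zeta5Search.Sweep
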